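import Summits.HodgeConjecture.HodgeConjecture.Theses.HeckePrymWeil
import Summits.HodgeConjecture.HodgeConjecture.Theorems.SummitOffWeilSector.Negative.ConjectureGrade
import Literature.AlgebraicGeometry.Motives.AbelianVarietyProjectiveChart
import Literature.AlgebraicGeometry.Motives.AbelianVarietyProductDimProofs
import Literature.AlgebraicGeometry.HodgeTheory.FermatHypersurfaceReduction
import Literature.AlgebraicGeometry.Motives.CurveNet
import Summits.HodgeConjecture.HodgeConjecture.Theorems.HeckePrymWeilHeckePrymAnchorsWeilSurface
import Summits.HodgeConjecture.HodgeConjecture.Theorems.HeckePrymWeilLadderGlue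
import Summits.HodgeConjecture.HodgeConjecture.Theorems.HeckePrymWeilIsoInvariance

/-!
# `HeckePrymAnchors` (stmt-HodgeConjecture-14496) · Negative · the constant-family bound and kill propagation

Negative-side support file of the standing crux disprover (cdisprove seat
`refuter-cdisprove-stmt-HodgeConjecture-14496-0`, cycles 1–2, 2026-08-16), extracted from the work file
`Cruxes/HeckePrymAnchors/Disproof.lean` §2–§3. Everything is unconditional and `sorry`-free; no
definition and no named fact is introduced.

Content. The crux `HeckePrymAnchors` asks, for every abelian `2n`-fold `(A, φ)` with `φ ≫ φ = -p`, for a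
Weil surface `(B, ψ)` such that every rational `(k,k)` class of `A × B` in the Weil span of `φ × ψ` is
ANCHORED by a smooth projective family with an algebraic member. This file proves:

* `exists_anchor_of_mem_algebraicClasses` — the CONSTANT family `C → (Spec ℂ, 𝟙)` anchors every
  ALGEBRAIC rational `(k,k)` class on an abelian `2k`-fold `(C, φ')` with `φ' ≫ φ' = -p` (base
  irreducible and smooth, `f` smooth of relative dimension `2k` and proper with smooth projective fibres
  by the tree's proved `AbelianVariety.isSmoothProjective_holds` and `IsSmoothProjective.of_iso` along
  `𝒳_s ≅ C`, the fibre inclusion being a base change of the isomorphism `Spec ℂ → Spec ℂ`; rationality,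
  Hodge type and algebraicity transported along it by `IsRationalClass.map`, `IsOfHodgeType.map_of_iso`,
  `map_mem_algebraicClasses_of_flat`);
* `prodEnd_comp_prodEnd` — `(φ × ψ) ≫ (φ × ψ) = -p` on `A × B`;
* `not_hodgeWeilLadder_of_not_heckePrymAnchors` — UNCONDITIONAL: a refutation of the crux refutes the
  route's TARGET `HodgeWeilLadder` (the Weil surface is the line's PROVED `stub_weilSurface`; the rung
  `(p, g)` in dimension `2k = (p-1)(g-1)` applied to `(A × B, φ × ψ)`, `dim (A × B) = 2k` by the proved
  `AbelianVariety.dim_prod`) — i.e. it is a non-algebraic rational Hodge–Weil class (kill criterion K4);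
* `not_hodgeConjecture_of_not_heckePrymAnchors` — UNCONDITIONAL: hence refutes the Hodge conjecture (via
  the landed `SummitOffWeilSector.Negative.antecedent_of_hodgeConjecture`), hence the standard conjecture
  B for the abelian variety `A × B` (André 1996 Thm. 0.6.2, barrier
  `Andre1996_hodgeClassesOnAbelianVarieties_motivated`);
* `not_heckePrymAnchors_iff_not_hodgeWeilLadder` — with the PROVED `LadderGlue` and `IsoInvariance`:
  given `WeilVariationalHodge`, `ProductDescent`, `WeilDescending`, `¬ crux ↔ ¬ target`;
* `two_le_g_of_k` — the hypothesis `2 ≤ g` of the crux is implied by `k = n + 1 = (p-1)/2 · (g-1)`.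
-/

noncomputable section

set_option linter.dupNamespace false

namespace Summit.HodgeConjecture.HodgeConjecture.Theorems.HeckePrymAnchors.Negative

open CategoryTheory AlgebraicGeometry Limits Complex
open Literature.AlgebraicGeometry.Motives Literature.AlgebraicGeometry.HodgeTheory
open Summit.HodgeConjecture.HodgeConjecture.Theses.HeckePrymWeil

/-! ## Arithmetic -/

/-- `2 ≤ g` follows from `k = n + 1` and `k = (p-1)/2 · (g-1)`: the hypothesis `2 ≤ g` of the crux is
decoration. [folklore] -/
theorem two_le_g_of_k {p g n k : ℕ} (hk : k = n + 1) (hkm : k = (p - 1) / 2 * (g - 1)) : 2 ≤ g := by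
  by_contra h
  have hg : g - 1 = 0 := by omega
  rw [hg, Nat.mul_zero] at hkm
  omega

/-! ## The product endomorphism -/

/-- `(φ × ψ) ≫ (φ × ψ) = -p` on `A × B` when `φ ≫ φ = -p` and `ψ ≫ ψ = -p`. [folklore] -/
theorem prodEnd_comp_prodEnd {A B : AbelianVariety ℂ} (φ : A ⟶ A) (ψ : B ⟶ B) (p : ℕ)
    (hφ : φ ≫ φ = -((p : ℤ) • 𝟙 A)) (hψ : ψ ≫ ψ = -((p : ℤ) • 𝟙 B)) :
    AbelianVariety.prodLift (AbelianVariety.fst A B ≫ φ) (AbelianVariety.snd A B ≫ ψ) ≫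
        AbelianVariety.prodLift (AbelianVariety.fst A B ≫ φ) (AbelianVariety.snd A B ≫ ψ) =
      -((p : ℤ) • 𝟙 (A.prod B)) := by
  apply AbelianVariety.prod_hom_ext
  · rw [Category.assoc, AbelianVariety.prodLift_fst, ← Category.assoc, AbelianVariety.prodLift_fst,
      Category.assoc, hφ]
    simp [Preadditive.comp_neg, Preadditive.neg_comp]
  · rw [Category.assoc, AbelianVariety.prodLift_snd, ← Category.assoc, AbelianVariety.prodLift_snd,
      Category.assoc, hψ]
    simp [Preadditive.comp_neg, Preadditive.neg_comp]

/-! ## The constant family anchors every algebraic class -/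

/-- **The constant family anchors every algebraic class** (conclusion = the crux's anchoring clause,
verbatim, for the scheme `C.X`): for an abelian `2k`-fold `(C, φ')` with `φ' ≫ φ' = -p`, every
rational `(k,k)` class `c ∈ algebraicClasses C.X k` is anchored by the CONSTANT family — `𝒳 = C`,
`S = (Spec ℂ, 𝟙)` (irreducible, `𝟙` smooth), `f` = the structure morphism (smooth of relative dimension
`2k`, proper, fibres smooth projective: the tree's proved `AbelianVariety.isSmoothProjective_holds` and
`IsSmoothProjective.of_iso`), `s₁ = s₀` = the point, `e = fiberι⁻¹ : C ≅ 𝒳_s` (the fibre inclusion is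
the base change of the isomorphism `Spec ℂ → Spec ℂ`), `W = c`; rationality, Hodge type and
algebraicity move along `fiberι` by `IsRationalClass.map`, `IsOfHodgeType.map_of_iso`,
`map_mem_algebraicClasses_of_flat`. [folklore] -/
theorem exists_anchor_of_mem_algebraicClasses (p k : ℕ) (C : AbelianVariety ℂ) (φ' : C ⟶ C) (hC : C.dim = 2 * k)
    (hφ' : φ' ≫ φ' = -((p : ℤ) • 𝟙 C)) (c : complexBetti C.X (2 * k)) (hrat : IsRationalClass c)
    (hh : IsOfHodgeType (2 * k) C.X (2 * k) k k c) (halg : c ∈ algebraicClasses C.X k) :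
    ∃ (𝒳 S : SchemeOver ℂ) (f : 𝒳 ⟶ S) (s₁ s₀ : ComplexPoints S) (e : C.X ≅ fiberOver f s₁) (W : complexBetti 𝒳 (2 * k)),
      IsSmoothProjectiveFamily f (2 * k) ∧ IrreducibleSpace S.left ∧ AlgebraicGeometry.Smooth S.hom ∧
      (∀ s : ComplexPoints S, IsRationalClass (complexBetti.map (fiberι f s) (2 * k) W) ∧
        IsOfHodgeType (2 * k) (fiberOver f s) (2 * k) k k (complexBetti.map (fiberι f s) (2 * k) W)) ∧
      (∀ s : ComplexPoints S, ∃ (A' : AbelianVariety ℂ) (φ'' : A' ⟶ A'), A'.dim = (2 * k) ∧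
        φ'' ≫ φ'' = -((p : ℤ) • 𝟙 A') ∧ Nonempty (A'.X ≅ fiberOver f s)) ∧
      complexBetti.map e.hom (2 * k) (complexBetti.map (fiberι f s₁) (2 * k) W) = c ∧
      complexBetti.map (fiberι f s₀) (2 * k) W ∈ algebraicClasses (fiberOver f s₀) k := by
  have hsp : IsSmoothProjective (2 * k) C.X := by
    have h := (AbelianVariety.isSmoothProjective_holds (A := C))
    rw [AbelianVariety.isSmoothProjective, hC] at h
    exact h
  -- the one-point base `(Spec ℂ, 𝟙)`, the constant family and the point
  let S : SchemeOver ℂ := Over.mk (𝟙 (Spec (CommRingCat.of ℂ)))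
  let f : C.X ⟶ S := Over.homMk C.X.hom (Category.comp_id _)
  let t : ComplexPoints S := Over.homMk (specOver ℂ ℂ).hom (Category.comp_id _)
  have hpt : ∀ s : ComplexPoints S, s.left = 𝟙 (Spec (CommRingCat.of ℂ)) := fun s => by
    have w := Over.w s
    change s.left ≫ 𝟙 _ = Spec.map (CommRingCat.ofHom (algebraMap ℂ ℂ)) at w
    rw [Category.comp_id] at w
    rw [w, Algebra.algebraMap_self, CommRingCat.ofHom_id, Spec.map_id]
  -- the fibre inclusions are isomorphisms
  haveI hleft : ∀ s : ComplexPoints S, IsIso (fiberι f s).left := fun s => by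
    haveI : IsIso s.left := by
      rw [hpt s]
      exact IsIso.id (Spec (CommRingCat.of ℂ))
    rw [fiberι_left]
    exact MorphismProperty.pullback_fst (P := MorphismProperty.isomorphisms Scheme) _ _
      ((MorphismProperty.isomorphisms.iff _).mpr ‹IsIso s.left›)
  haveI hiso : ∀ s : ComplexPoints S, IsIso (fiberι f s) := fun s => by
    haveI : IsIso ((Over.forget _).map (fiberι f s)) := hleft s
    exact isIso_of_reflects_iso _ (Over.forget _)
  let e : ∀ s : ComplexPoints S, C.X ≅ fiberOver f s := fun s => (asIso (fiberι f s)).symm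
  have he : ∀ s : ComplexPoints S, (e s).hom ≫ fiberι f s = 𝟙 _ := fun s => (asIso (fiberι f s)).inv_hom_id
  have hfam : IsSmoothProjectiveFamily f (2 * k) :=
    ⟨hsp.smoothOfRelativeDimension, (inferInstance : IsProper C.X.hom), fun s => hsp.of_iso (e s)⟩
  have hirr : IrreducibleSpace S.left := by
    change IrreducibleSpace (Spec (CommRingCat.of ℂ) : Scheme)
    infer_instance
  have hsm : AlgebraicGeometry.Smooth S.hom := by
    change AlgebraicGeometry.Smooth (𝟙 _)
    infer_instance
  refine ⟨C.X, S, f, t, t, e t, c, hfam, hirr, hsm,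
    fun s => ⟨hrat.map _, hh.map_of_iso (asIso (fiberι f s))⟩,
    fun s => ⟨C, φ', hC, hφ', ⟨e s⟩⟩, ?_, ?_⟩
  · change (complexBetti.map (fiberι f t) (2 * k) ≫ complexBetti.map (e t).hom (2 * k)) c = c
    rw [← complexBetti.map_comp, he, complexBetti.map_id]
    rfl
  · haveI : IsLocallyNoetherian C.X.left := IsSmoothProjective.isLocallyNoetherian_holds hsp
    haveI : IsLocallyNoetherian (fiberOver f t).left :=
      IsSmoothProjective.isLocallyNoetherian_holds (hsp.of_iso (e t))
    exact map_mem_algebraicClasses_of_flat (fiberι f t) halg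

/-! ## Kill propagation (unconditional: the Weil surface is the line's PROVED `stub_weilSurface`) -/

/-- **A refutation of the crux refutes the route's target**: `¬ HeckePrymAnchors → ¬ HodgeWeilLadder`.
Proof: the Weil surface `(B, ψ)` is the line's PROVED `HeckePrymWeilLine.stub_weilSurface`
(`B = E × E`, `ψ` the companion of `T² + p`, `b = pr₁^*ω - p·pr₂^*ω`); the rung `(p, g)` of the
ladder in dimension `2k = (p-1)(g-1)` applied to `(A × B, φ × ψ)` (`dim = 2k` by
`AbelianVariety.dim_prod`, `(φ×ψ)² = -p` by `prodEnd_comp_prodEnd`) makes `c` algebraic, and the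
constant family anchors it (`exists_anchor_of_mem_algebraicClasses`). So a kill of the crux is a
non-algebraic rational Hodge–Weil class on some `A × B` (route kill criterion K4). [folklore] -/
theorem not_hodgeWeilLadder_of_not_heckePrymAnchors (h : ¬ HeckePrymAnchors) : ¬ HodgeWeilLadder := by
  intro hL
  apply h
  intro p hp hp4 hp7 g hg n k _ hkm A φ hA hφ
  obtain ⟨B, ψ, hBdim, hψ, hb⟩ := HeckePrymWeilLine.stub_weilSurface p hp hp4 hp7
  refine ⟨B, ψ, hBdim, hψ, hb, fun c hrat hh hw => ?_⟩
  have hdim : (A.prod B).dim = 2 * k := by rw [AbelianVariety.dim_prod, hA, hBdim]; omega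
  have hsq := prodEnd_comp_prodEnd φ ψ p hφ hψ
  exact exists_anchor_of_mem_algebraicClasses p k (A.prod B) _ hdim hsq c hrat hh
    (hL p hp hp4 hp7 g hg k hkm (A.prod B) _ hdim hsq c hrat hh hw)

/-- **A refutation of the crux refutes the Hodge conjecture**: `¬ HeckePrymAnchors → ¬ HodgeConjecture`
(through the landed `SummitOffWeilSector.Negative.antecedent_of_hodgeConjecture`, HC ⇒ every rung) —
hence, the class living on the abelian variety `A × B`, the standard conjecture B (André 1996,
Thm. 0.6.2). [cite: Andre1996Motifs, Thm. 0.6.2] -/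
theorem not_hodgeConjecture_of_not_heckePrymAnchors (h : ¬ HeckePrymAnchors) : ¬ _root_.HodgeConjecture := by
  intro hHC
  apply h
  intro p hp hp4 hp7 g hg n k _ hkm A φ hA hφ
  obtain ⟨B, ψ, hBdim, hψ, hb⟩ := HeckePrymWeilLine.stub_weilSurface p hp hp4 hp7
  refine ⟨B, ψ, hBdim, hψ, hb, fun c hrat hh hw => ?_⟩
  have hdim : (A.prod B).dim = 2 * k := by rw [AbelianVariety.dim_prod, hA, hBdim]; omega
  have hsq := prodEnd_comp_prodEnd φ ψ p hφ hψ
  have hk1 : 1 ≤ k := by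
    have hm : 3 ≤ (p - 1) / 2 := by omega
    have hg1 : 1 ≤ g - 1 := by omega
    have := Nat.mul_le_mul hm hg1
    omega
  exact exists_anchor_of_mem_algebraicClasses p k (A.prod B) _ hdim hsq c hrat hh
    (SummitOffWeilSector.Negative.antecedent_of_hodgeConjecture hHC p hp hp4 hp7 k hk1
      (A.prod B) _ hdim hsq c hrat hh hw)

/-- **The crux fails iff the target fails, given the two open supports and the transport crux.**
With the route's PROVED glue `heckePrymWeil_ladderGlue_proof : LadderGlue` and PROVED support
`isoInvariance_proof : IsoInvariance`: under `WeilVariationalHodge`, `ProductDescent`,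
`WeilDescending` the crux and the target `HodgeWeilLadder` are equivalent — the crux carries exactly
the open content of the target, no more (this file) and no less (the glue). [folklore] -/
theorem not_heckePrymAnchors_iff_not_hodgeWeilLadder (hV : WeilVariationalHodge) (hP : ProductDescent)
    (hD : WeilDescending) : ¬ HeckePrymAnchors ↔ ¬ HodgeWeilLadder :=
  ⟨not_hodgeWeilLadder_of_not_heckePrymAnchors,
    fun hL h => hL (heckePrymWeil_ladderGlue_proof h hV isoInvariance_proof hP hD)⟩

end Summit.HodgeConjecture.HodgeConjecture.Theorems.HeckePrymAnchors.Negative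

end
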